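import Literature.Computability.Complexity.FPRASTransfer
import Literature.Computability.Complexity.SelectBricks
import Literature.Computability.Complexity.StackBricksLists
import Literature.Computability.Complexity.ListFoldChecks
import Literature.Computability.Complexity.MajorityVote
import Literature.Computability.Complexity.CoinChunks
import HarnessLib

/-!
# Confidence amplification for FPRASes: the textbook `3/4`-FPRAS gives an FPRAS with confidence parameter

Sequel of `FPRAS.lean` (the two FPRAS notions `ThreeQuartersFPRAS N` — success probability the
constant `3/4`, Dyer–Goldberg–Greenhill–Jerrum 2003 §1 — and `HasFPRAS N` — confidence `1 - 1/kδ` read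
off the query in unary) and of `FPRASTransfer.lean`. The converse of `HasFPRAS.threeQuartersFPRAS`:

* `hasFPRAS_of_threeQuarters : ThreeQuartersFPRAS N → HasFPRAS N`, `hasFPRAS_iff_threeQuarters`.

This is the median trick of Jerrum–Valiant–Vazirani (1986, Lemma 6.1, the "powering lemma" quoted by
DGGJ: "the failure probability may be made negligible through repeated trials"): run the `3/4`-scheme
`m = 4kδ + 1` times on fresh coin blocks and output the MEDIAN of the estimates; if a strict majority
of the runs is within the ratio `1 + 1/kη`, so is the median, and by the weak law of large numbers
(Chebyshev form, the tree's `card_majority_fail_le`, `MajorityVote.lean`: `m ≥ 1/(4δη²)` trials with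
`η = 1/4`, `δ = 1/kδ`) a strict majority fails with probability `≤ 1/kδ`. (JVV and DGGJ use
`O(log δ⁻¹)` trials and a Chernoff bound; the polynomial number `4kδ + 1` of trials that Chebyshev
needs is equally polynomial in the unary confidence parameter, and keeps the proof inside the tree's
counting toolkit.)

The transducer is assembled in the brick algebra, no machine is written: the list of the `m`
canonicalised estimates is produced by the concatenation fold `Brick.foldLoop appF` (`FoldBricks.lean`)
of the piece function "estimate on coin block `i`" (blocks cut with `HashBricks.umulFn`), sorted by
value with `Brick.isortFn` (`StackBricksLists.lean`, model `Com.isortModel`), and the middle item is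
read with `HashBricks.nthItemFn`. The probability is transported from coin strings to tuples of blocks
by `chunkVec` / `uniformProb_eq_card_of_bijective` (`CoinChunks.lean`).

All proved; no named fact.

## References

* M. R. Jerrum, L. G. Valiant, V. V. Vazirani, *Random generation of combinatorial structures from a
  uniform distribution*, Theoret. Comput. Sci. 43 (1986) 169–188, Lemma 6.1 [JerrumValiantVazirani1986].
* M. Dyer, L. A. Goldberg, C. Greenhill, M. Jerrum, Algorithmica 38 (2003) 471–500, §1 [DyerEtAl2003].
* S. Arora, B. Barak, *Computational Complexity: A Modern Approach*, CUP 2009, §7.4.1 [AroraBarak2009].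
-/

noncomputable section

open scoped Classical

namespace Literature.Computability.Complexity

open _root_.Computability Polynomial Brick Plumb OracleCompose HashBricks

namespace FPRASAmp

/-! ### The median of a list with a strict majority in an interval -/

section Median

/-- The value order on strings. [folklore] -/
def ValLE (a b : List Bool) : Prop := bitsToNat a ≤ bitsToNat b

/-- The value order is decidable. [folklore] -/
instance : DecidableRel ValLE := fun a b => inferInstanceAs (Decidable (bitsToNat a ≤ bitsToNat b))

/-- The value order is total. [folklore] -/
instance : Std.Total ValLE := ⟨fun a b => le_total (bitsToNat a) (bitsToNat b)⟩

/-- The value order is transitive. [folklore] -/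
instance : IsTrans (List Bool) ValLE := ⟨fun _ _ _ h h' => le_trans h h'⟩

/-- `Com.insModel` is `orderedInsert` for the value order. [folklore] -/
theorem insModel_eq (v : List Bool) (l : List (List Bool)) : Com.insModel v l = l.orderedInsert ValLE v := rfl

/-- The insertion-sort model returns a list sorted (pairwise ordered) by value, from a sorted
accumulator. [folklore] -/
theorem pairwise_isortModel : ∀ (l acc : List (List Bool)), acc.Pairwise ValLE → (Com.isortModel acc l).Pairwise ValLE
  | [], acc, h => h
  | e :: l, acc, h => by
    have h1 : (Com.insModel e acc).Pairwise ValLE := by rw [insModel_eq]; exact h.orderedInsert e acc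
    exact pairwise_isortModel l _ h1

/-- Counting over `List.ofFn` is counting over `Fin m`. [folklore] -/
theorem countP_ofFn {α : Type*} (p : α → Bool) : ∀ {m : ℕ} (f : Fin m → α),
    (List.ofFn f).countP p = ∑ i : Fin m, if p (f i) = true then 1 else 0
  | 0, f => by simp
  | m + 1, f => by
    rw [List.ofFn_succ, List.countP_cons, countP_ofFn p (fun i => f i.succ), Fin.sum_univ_succ, Nat.add_comm]

/-- Counting over `List.ofFn`, as the cardinality of a filter of `Fin m`. [folklore] -/
theorem countP_ofFn_eq_card {α : Type*} (p : α → Bool) {m : ℕ} (f : Fin m → α) :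
    (List.ofFn f).countP p = (Finset.univ.filter fun i : Fin m => p (f i) = true).card := by
  rw [countP_ofFn, Finset.card_filter]

/-- **The median of a strict majority.** If a list `S` of length `m` is sorted by value and more than
half of its elements satisfy a predicate that is an INTERVAL condition on the value (`lo ≤ · ≤ hi` in
`ℝ`), then so does its middle element `S[m/2]`. [cite: JerrumValiantVazirani1986, Lemma 6.1 (proof)] -/
theorem interval_of_majority {S : List (List Bool)} (hS : S.Pairwise ValLE) {lo hi : ℝ}
    (hmaj : S.length < 2 * S.countP fun a => decide (lo ≤ bitsToNat a ∧ (bitsToNat a : ℝ) ≤ hi)) :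
    lo ≤ bitsToNat (S.getD (S.length / 2) []) ∧ (bitsToNat (S.getD (S.length / 2) []) : ℝ) ≤ hi := by
  set m := S.length with hm
  set P : List Bool → Bool := fun a => decide (lo ≤ bitsToNat a ∧ (bitsToNat a : ℝ) ≤ hi) with hP
  have hne : S ≠ [] := by rintro rfl; simp at hmaj
  have hlt : m / 2 < m := Nat.div_lt_self (List.length_pos_iff.2 hne) one_lt_two
  -- split `S` around its middle element
  set mid := S[m / 2]'hlt with hmid
  have hgetD : S.getD (m / 2) [] = mid := by
    rw [List.getD_eq_getElem?_getD, List.getElem?_eq_getElem hlt, Option.getD_some]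
  rw [hgetD]
  have hsplit : S = S.take (m / 2) ++ mid :: S.drop (m / 2 + 1) := by
    rw [hmid, ← List.drop_eq_getElem_cons hlt, List.take_append_drop]
  have hlenT : (S.take (m / 2)).length = m / 2 := by rw [List.length_take]; omega
  have hlenD : (S.drop (m / 2 + 1)).length = m - (m / 2 + 1) := by rw [List.length_drop]
  -- order across the split
  have hsorted := hS
  rw [hsplit, List.pairwise_append, List.pairwise_cons] at hsorted
  obtain ⟨-, ⟨hmidD, -⟩, hTmid⟩ := hsorted
  -- counting across the split
  have hcount : S.countP P = (S.take (m / 2)).countP P + ((S.drop (m / 2 + 1)).countP P + if P mid = true then 1 else 0) := by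
    conv_lhs => rw [hsplit]
    rw [List.countP_append, List.countP_cons]
  have hcT : (S.take (m / 2)).countP P ≤ (S.take (m / 2)).length := List.countP_le_length ..
  have hcD : (S.drop (m / 2 + 1)).countP P ≤ (S.drop (m / 2 + 1)).length := List.countP_le_length ..
  by_contra hnot
  rw [not_and_or, not_le, not_le] at hnot
  rcases hnot with hlo | hhi
  · -- the middle value is too small: so is everything before it
    have hT0 : (S.take (m / 2)).countP P = 0 := by
      rw [List.countP_eq_zero]
      intro a ha
      have hle : bitsToNat a ≤ bitsToNat mid := hTmid a ha mid List.mem_cons_self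
      have hlt' : (bitsToNat a : ℝ) < lo := lt_of_le_of_lt (by exact_mod_cast hle) hlo
      simp only [hP, decide_eq_true_eq, not_and]
      exact fun h => absurd h (not_le.2 hlt')
    have hPmid : P mid = false := by
      simp only [hP, decide_eq_false_iff_not, not_and]
      exact fun h => absurd h (not_le.2 hlo)
    rw [hT0, hPmid] at hcount
    simp only [Bool.false_eq_true, if_false, zero_add, add_zero] at hcount
    rw [hcount] at hmaj
    omega
  · -- the middle value is too large: so is everything after it
    have hD0 : (S.drop (m / 2 + 1)).countP P = 0 := by
      rw [List.countP_eq_zero]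
      intro a ha
      have hle : bitsToNat mid ≤ bitsToNat a := hmidD a ha
      have hlt' : hi < (bitsToNat a : ℝ) := lt_of_lt_of_le hhi (by exact_mod_cast hle)
      simp only [hP, decide_eq_true_eq, not_and, not_le]
      exact fun _ => hlt'
    have hPmid : P mid = false := by
      simp only [hP, decide_eq_false_iff_not, not_and, not_le]
      exact fun _ => hhi
    rw [hD0, hPmid] at hcount
    simp only [Bool.false_eq_true, if_false, add_zero] at hcount
    rw [hcount] at hmaj
    omega

end Median

/-! ### Blocks of a coin string and the chunk bijection -/

section Blocks

/-- Block `i < m` of a string is block `i` of its prefix of length `m ℓ`. [folklore] -/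
theorem blk_take (ℓ m : ℕ) {i : ℕ} (hi : i < m) (U : List Bool) :
    APTransfer.blk ℓ i (U.take (m * ℓ)) = APTransfer.blk ℓ i U := by
  unfold APTransfer.blk
  rw [List.drop_take, List.take_take]
  congr 1
  have : (i + 1) * ℓ ≤ m * ℓ := Nat.mul_le_mul_right ℓ hi
  rw [Nat.succ_mul] at this
  omega

/-- Block `i` of a string of length `m ℓ` is its `chunkVec` component. [folklore] -/
theorem blk_eq_chunkVec {ℓ m : ℕ} (w : List Bool) (hw : w.length = m * ℓ) (i : Fin m) :
    APTransfer.blk ℓ i w = (chunkVec ⟨w, hw⟩ i).toList := rfl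

end Blocks

/-! ### The string functions of the median machine -/

section Bricks

variable (c s : Polynomial ℕ) (F : List Bool → List Bool)

/-- `1^{4kδ+1}`: the number of trials `m` in unary, off the FPRAS query `W`. [folklore] -/
def mUF : List Bool → List Bool :=
  List.cons true ∘ fun W => APTransfer.deltaF W ++ (fun W => APTransfer.deltaF W ++
    (fun W => APTransfer.deltaF W ++ APTransfer.deltaF W) W) W
/-- `1^{2kδ} = 1^{m/2}`: the index of the median. [folklore] -/
def halfUF : List Bool → List Bool := fun W => APTransfer.deltaF W ++ APTransfer.deltaF W
/-- `1^{ℓ}`, `ℓ = c(|x| + kη)`: the coin block of one trial. [folklore] -/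
def ellUF : List Bool → List Bool := polyFn c ∘ fun W => APTransfer.xF W ++ APTransfer.etaF W
/-- The header `⟨x, ⟨1⁰, ⟨1^{kη}, 1⁴⟩⟩⟩` of the trials' queries (confidence slot `4`). [folklore] -/
def hdr4F : List Bool → List Bool :=
  fanoutFn APTransfer.xF (fanoutFn (fun _ => []) (fanoutFn APTransfer.etaF fun _ => unaryEncodeNat 4))
/-- The pad `1^{s(|⟨hdr4, 1^ℓ⟩|)}` bounding the size of one estimate. [folklore] -/
def padF : List Bool → List Bool := polyFn s ∘ fanoutFn hdr4F (ellUF c)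
/-- The fold context `X = ⟨hdr4, ⟨1^ℓ, ⟨pad, ⟨1^{kδ}, U⟩⟩⟩⟩`. [folklore] -/
def ctxF : List Bool → List Bool :=
  fanoutFn hdr4F (fanoutFn (ellUF c) (fanoutFn (padF c s) (fanoutFn APTransfer.deltaF sndF)))

/-- On a piece argument `r = ⟨X, 1ʲ⟩`: coin block `j` of `U`. [folklore] -/
def blkPF : List Bool → List Bool :=
  takeFn ∘ fanoutFn (nthF 1 ∘ fstF) (dropFn ∘ fanoutFn (umulFn ∘ fanoutFn sndF (nthF 1 ∘ fstF)) (sndPow 3 ∘ fstF))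
/-- On a piece argument: the query `⟨hdr4, block j⟩` of trial `j`. [folklore] -/
def qPF : List Bool → List Bool := fanoutFn (nthF 0 ∘ fstF) blkPF
/-- **The piece function**: the one-item frame `⟨canonF (F (query j)), ε⟩` of trial `j`'s estimate,
canonicalised (`Brick.canonF`) so that sorting by value sorts by the estimate. [folklore] -/
def pieceF : List Bool → List Bool := fanoutFn (canonF ∘ F ∘ qPF) fun _ => []
/-- The fold's input record `⟨X, ⟨bin m, ⟨1⁰, ε⟩⟩⟩`. [folklore] -/
def foldInF : List Bool → List Bool :=
  fanoutFn (ctxF c s) (fanoutFn (lenBinF ∘ mUF) fun _ => boolPair [] [])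
/-- The coded list of the `m` canonical estimates (the accumulator of the concatenation fold, clipped
pieces, `4|X| + 1 ≥ m` rounds). [folklore] -/
def listF : List Bool → List Bool :=
  sndPow 2 ∘ foldLoop appF (clipF 4 (pieceF F)) (4 * X + 1) ∘ foldInF c s
/-- **The median transducer**: sort the estimates by value and read the item of rank `m/2 = 2kδ`.
[cite: JerrumValiantVazirani1986, Lemma 6.1] -/
def medF : List Bool → List Bool := nthItemFn ∘ fanoutFn halfUF (isortFn ∘ listF c s F)

/-! Membership in `FP`. -/

/-- `mUF ∈ FP`. [folklore] -/
theorem mUF_mem_FP : mUF ∈ FP :=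
  comp_mem_FP (cons_mem_FP true) (append_mem_FP APTransfer.deltaF_mem_FP
    (append_mem_FP APTransfer.deltaF_mem_FP (append_mem_FP APTransfer.deltaF_mem_FP APTransfer.deltaF_mem_FP)))
/-- `halfUF ∈ FP`. [folklore] -/
theorem halfUF_mem_FP : halfUF ∈ FP := append_mem_FP APTransfer.deltaF_mem_FP APTransfer.deltaF_mem_FP
/-- `ellUF c ∈ FP`. [folklore] -/
theorem ellUF_mem_FP : ellUF c ∈ FP :=
  comp_mem_FP (polyFn_mem_FP c) (append_mem_FP APTransfer.xF_mem_FP APTransfer.etaF_mem_FP)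
/-- `hdr4F ∈ FP`. [folklore] -/
theorem hdr4F_mem_FP : hdr4F ∈ FP :=
  fanoutFn_mem_FP APTransfer.xF_mem_FP (fanoutFn_mem_FP (const_mem_FP _)
    (fanoutFn_mem_FP APTransfer.etaF_mem_FP (const_mem_FP _)))
/-- `padF c s ∈ FP`. [folklore] -/
theorem padF_mem_FP : padF c s ∈ FP := comp_mem_FP (polyFn_mem_FP s) (fanoutFn_mem_FP hdr4F_mem_FP (ellUF_mem_FP c))
/-- `ctxF c s ∈ FP`. [folklore] -/
theorem ctxF_mem_FP : ctxF c s ∈ FP :=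
  fanoutFn_mem_FP hdr4F_mem_FP (fanoutFn_mem_FP (ellUF_mem_FP c) (fanoutFn_mem_FP (padF_mem_FP c s)
    (fanoutFn_mem_FP APTransfer.deltaF_mem_FP sndF_mem_FP)))
/-- `blkPF ∈ FP`. [folklore] -/
theorem blkPF_mem_FP : blkPF ∈ FP :=
  comp_mem_FP takeFn_mem_FP (fanoutFn_mem_FP (comp_mem_FP (nthF_mem_FP 1) fstF_mem_FP)
    (comp_mem_FP dropFn_mem_FP (fanoutFn_mem_FP
      (comp_mem_FP umulFn_mem_FP (fanoutFn_mem_FP sndF_mem_FP (comp_mem_FP (nthF_mem_FP 1) fstF_mem_FP)))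
      (comp_mem_FP (sndPow_mem_FP 3) fstF_mem_FP))))
/-- `qPF ∈ FP`. [folklore] -/
theorem qPF_mem_FP : qPF ∈ FP := fanoutFn_mem_FP (comp_mem_FP (nthF_mem_FP 0) fstF_mem_FP) blkPF_mem_FP
/-- `pieceF F ∈ FP` for `F ∈ FP`. [folklore] -/
theorem pieceF_mem_FP {F : List Bool → List Bool} (hF : F ∈ FP) : pieceF F ∈ FP :=
  fanoutFn_mem_FP (comp_mem_FP canonF_mem_FP (comp_mem_FP hF qPF_mem_FP)) (const_mem_FP _)
/-- `foldInF c s ∈ FP`. [folklore] -/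
theorem foldInF_mem_FP : foldInF c s ∈ FP :=
  fanoutFn_mem_FP (ctxF_mem_FP c s) (fanoutFn_mem_FP (comp_mem_FP lenBinF_mem_FP mUF_mem_FP) (const_mem_FP _))
/-- `listF c s F ∈ FP` for `F ∈ FP` (the clipped concatenation fold, `foldLoop_clipF_mem_FP`). [folklore] -/
theorem listF_mem_FP {F : List Bool → List Bool} (hF : F ∈ FP) : listF c s F ∈ FP :=
  comp_mem_FP (sndPow_mem_FP 2) (comp_mem_FP
    (foldLoop_clipF_mem_FP 4 appF_mem_FP length_appF_le (pieceF_mem_FP hF) _) (foldInF_mem_FP c s))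
/-- **`medF c s F ∈ FP`** for `F ∈ FP`. [cite: AroraBarak2009, §1.3] -/
theorem medF_mem_FP {F : List Bool → List Bool} (hF : F ∈ FP) : medF c s F ∈ FP :=
  comp_mem_FP nthItemFn_mem_FP (fanoutFn_mem_FP halfUF_mem_FP (comp_mem_FP isortFn_mem_FP (listF_mem_FP c s hF)))

/-! Values on the FPRAS query `W = countQuery x 0 kη kδ U`. -/

variable (x : List Bool) (kη kδ : ℕ) (U : List Bool)

/-- The number of trials. [folklore] -/
def mOf (kδ : ℕ) : ℕ := 4 * kδ + 1

/-- The block length. [folklore] -/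
def ellOf : ℕ := c.eval (x.length + kη)

/-- The header of the trials' queries. [folklore] -/
def hdr4 : List Bool := boolPair x (boolPair (unaryEncodeNat 0) (boolPair (unaryEncodeNat kη) (unaryEncodeNat 4)))

/-- `countQuery x 0 kη 4 v = ⟨hdr4, v⟩`. [folklore] -/
theorem countQuery_four (v : List Bool) : countQuery x 0 kη 4 v = boolPair (hdr4 x kη) v := rfl

/-- `m / 2 = 2kδ`. [folklore] -/
theorem mOf_div_two : mOf kδ / 2 = kδ + kδ := by unfold mOf; omega

/-- The value of `mUF`. [folklore] -/
theorem mUF_W : mUF (countQuery x 0 kη kδ U) = ones (mOf kδ) := by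
  have h : mUF (countQuery x 0 kη kδ U) = unaryEncodeNat (kδ + (kδ + (kδ + kδ)) + 1) := by
    simp only [mUF, Function.comp_apply, APTransfer.deltaF_W, APTransfer.unary_append]
    rfl
  rw [h, APTransfer.ones_eq_unary, mOf]
  congr 1
  omega
/-- The value of `halfUF`. [folklore] -/
theorem halfUF_W : halfUF (countQuery x 0 kη kδ U) = ones (kδ + kδ) := by
  simp only [halfUF, APTransfer.deltaF_W, APTransfer.unary_append, APTransfer.ones_eq_unary]
/-- The value of `ellUF`. [folklore] -/
theorem ellUF_W : ellUF c (countQuery x 0 kη kδ U) = ones (ellOf c x kη) := by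
  simp only [ellUF, Function.comp_apply, APTransfer.xF_W, APTransfer.etaF_W, polyFn_apply, List.length_append,
    APTransfer.length_unary, ellOf]
/-- The value of `hdr4F`. [folklore] -/
theorem hdr4F_W : hdr4F (countQuery x 0 kη kδ U) = hdr4 x kη := by
  simp only [hdr4F, fanoutFn_apply, APTransfer.xF_W, APTransfer.etaF_W, hdr4, APTransfer.unary_zero]

/-- The pad length `s(|⟨hdr4, 1^ℓ⟩|)`. [folklore] -/
def padOf : ℕ := s.eval (2 * (hdr4 x kη).length + 2 + ellOf c x kη)

/-- The value of `padF`. [folklore] -/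
theorem padF_W : padF c s (countQuery x 0 kη kδ U) = ones (padOf c s x kη) := by
  simp only [padF, Function.comp_apply, fanoutFn_apply, hdr4F_W, ellUF_W, polyFn_apply, length_boolPair,
    List.length_replicate, padOf]

/-- The fold context on `W`. [folklore] -/
def ctxOf : List Bool :=
  boolPair (hdr4 x kη) (boolPair (ones (ellOf c x kη)) (boolPair (ones (padOf c s x kη)) (boolPair (unaryEncodeNat kδ) U)))

/-- The value of `ctxF`. [folklore] -/
theorem ctxF_W : ctxF c s (countQuery x 0 kη kδ U) = ctxOf c s x kη kδ U := by
  have hs : sndF (countQuery x 0 kη kδ U) = U := by simp [countQuery]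
  simp only [ctxF, fanoutFn_apply, hdr4F_W, ellUF_W, padF_W, APTransfer.deltaF_W, hs, ctxOf]

/-- The context is at least as long as the pad and as `kδ`. [folklore] -/
theorem padOf_add_le_length_ctxOf : padOf c s x kη + kδ ≤ (ctxOf c s x kη kδ U).length := by
  simp only [ctxOf, length_boolPair, List.length_replicate, APTransfer.length_unary]
  omega

/-- **The value of the piece function** on `⟨X, 1ʲ⟩`: the frame of the canonical estimate of trial `j`,
run on coin block `j`. [folklore] -/
theorem pieceF_apply (j : ℕ) :
    pieceF F (boolPair (ctxOf c s x kη kδ U) (ones j)) =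
      boolPair (canonF (F (countQuery x 0 kη 4 (APTransfer.blk (ellOf c x kη) j U)))) [] := by
  simp only [pieceF, qPF, blkPF, ctxOf, fanoutFn_apply, Function.comp_apply, fstF_boolPair, sndF_boolPair,
    nthF_succ_boolPair, nthF_zero, sndPow_succ_boolPair, sndPow_zero_boolPair, umulFn_apply, List.length_replicate,
    takeFn_boolPair, dropFn_boolPair, countQuery_four, APTransfer.blk]

/-- The items folded: the canonical estimates. [folklore] -/
def item (j : ℕ) : List Bool := canonF (F (countQuery x 0 kη 4 (APTransfer.blk (ellOf c x kη) j U)))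

/-- **The pieces are short** (within the clip `4 (|X| + 1)`), for `s` bounding the output length of `F`.
[folklore] -/
theorem length_pieceF_le (hs : ∀ w, (F w).length ≤ s.eval w.length) (j : ℕ) :
    (pieceF F (boolPair (ctxOf c s x kη kδ U) (ones j))).length ≤ 4 * ((ctxOf c s x kη kδ U).length + 1) := by
  rw [pieceF_apply, length_boolPair, List.length_nil]
  have h1 := length_canonF_le (F (countQuery x 0 kη 4 (APTransfer.blk (ellOf c x kη) j U)))
  have h2 := hs (countQuery x 0 kη 4 (APTransfer.blk (ellOf c x kη) j U))
  have h3 : (countQuery x 0 kη 4 (APTransfer.blk (ellOf c x kη) j U)).length ≤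
      2 * (hdr4 x kη).length + 2 + ellOf c x kη := by
    rw [countQuery_four, length_boolPair]
    have : (APTransfer.blk (ellOf c x kη) j U).length ≤ ellOf c x kη := by
      unfold APTransfer.blk; exact List.length_take_le _ _
    omega
  have h4 := TM2Iter.eval_mono s h3
  have h5 := padOf_add_le_length_ctxOf c s x kη kδ U
  rw [← padOf] at h4
  omega

/-- **The value of the list function**: the code of the list of the `m` canonical estimates.
[folklore] -/
theorem listF_W (hs : ∀ w, (F w).length ≤ s.eval w.length) :
    listF c s F (countQuery x 0 kη kδ U) = encList (List.ofFn fun j : Fin (mOf kδ) => item c F x kη U j) := by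
  have hm : mOf kδ ≤ (4 * X + 1).eval (ctxOf c s x kη kδ U).length := by
    have := padOf_add_le_length_ctxOf c s x kη kδ U
    simp only [eval_add, eval_mul, eval_ofNat, eval_X, eval_one, mOf]
    omega
  simp only [listF, Function.comp_apply, foldInF, fanoutFn_apply, ctxF_W, mUF_W, lenBinF_apply, List.length_replicate]
  rw [show boolPair ([] : List Bool) [] = boolPair (ones 0) [] from rfl, foldLoop_apply _ _ hm,
    sndPow_succ_boolPair, sndPow_succ_boolPair, sndPow_zero_boolPair,
    foldAcc_clipF (fun j _ _ => length_pieceF_le c s F x kη kδ U hs j), foldAcc_appF, List.nil_append,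
    ← frames_eq_encList, frames_ofFn_eq_ccat_boolPair]
  exact ccat_congr fun j _ => by rw [Nat.zero_add, pieceF_apply]; rfl

/-- `nthItemFn ⟨1ʲ, encList l⟩ = l[j]` (twin of `Brick.nthItemFn_encList` of
`GoldwasserSipserRefereeBricks.lean`, outside this file's import cone; via `nthItemFn_body`). [folklore] -/
theorem nthItemFn_encList' (j : ℕ) (l : List (List Bool)) :
    nthItemFn (boolPair (ones j) (encList l)) = l.getD j [] := by
  have : ∀ l : List (List Bool), body l = encList l := by
    intro l; induction l with
    | nil => rfl
    | cons a l ih => rw [body_cons, encList_cons, ih]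
  rw [← this, nthItemFn_body]

/-- **The value of the median transducer**: the item of rank `m/2` of the sorted list of canonical
estimates. [cite: JerrumValiantVazirani1986, Lemma 6.1] -/
theorem medF_W (hs : ∀ w, (F w).length ≤ s.eval w.length) :
    medF c s F (countQuery x 0 kη kδ U) =
      (Com.isortModel [] (List.ofFn fun j : Fin (mOf kδ) => item c F x kη U j)).getD (mOf kδ / 2) [] := by
  simp only [medF, Function.comp_apply, fanoutFn_apply, halfUF_W, listF_W c s F x kη kδ U hs, isortFn_encList,
    nthItemFn_encList', mOf_div_two]

end Bricks

/-! ### The amplification theorem -/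

section Amplify

variable {N : List Bool → ℕ}

/-- The items are canonical numerals: `decodeNat = bitsToNat` on them and on every member of a
permutation of them. [folklore] -/
theorem decodeNat_eq_bitsToNat_of_mem {c : Polynomial ℕ} {F : List Bool → List Bool} {x U : List Bool} {kη m : ℕ}
    {S : List (List Bool)} (hS : S.Perm (List.ofFn fun j : Fin m => item c F x kη U j)) {a : List Bool}
    (ha : a ∈ S ∨ a = []) : decodeNat a = bitsToNat a := by
  rcases ha with ha | rfl
  · obtain ⟨j, hj⟩ := (List.mem_ofFn' _ _).1 (hS.mem_iff.1 ha)
    rw [← hj]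
    simp only [item, canonF_eq_encodeNat_decodeNat, decode_encodeNat, bitsToNat_encodeNat]
  · rfl

/-- **JVV amplification: a `3/4`-FPRAS is an FPRAS with confidence parameter.** Run the scheme
`m = 4kδ + 1` times on fresh coin blocks of length `c(|x| + kη)` and output the median estimate
(`medF`): a strict majority of the runs is within the ratio except with probability `≤ 1/kδ`
(`card_majority_fail_le` with `η = 1/4`, `δ = 1/kδ`, `m ≥ 4kδ = 1/(4δη²)`), and then the median is
within the ratio (`interval_of_majority`). [cite: JerrumValiantVazirani1986, Lemma 6.1]
[cite: DyerEtAl2003, §1 ("the failure probability may be made negligible through repeated trials")] -/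
theorem hasFPRAS_of_threeQuarters (h : ThreeQuartersFPRAS N) : HasFPRAS N := by
  obtain ⟨F, hF, c, hc⟩ := h
  obtain ⟨s, hs⟩ := exists_poly_length_le_of_mem_FP hF
  refine ⟨medF c s F, medF_mem_FP c s hF, (4 * X + 1) * c, fun x kη kδ hkη hkδ => ?_⟩
  set m := mOf kδ with hm
  set ℓ := ellOf c x kη with hℓ
  have hmpos : 0 < m := by rw [hm, mOf]; omega
  -- the coin budget covers `m` blocks
  have hcover : m * ℓ ≤ ((4 * X + 1) * c).eval (x.length + kη + kδ) := by
    simp only [eval_mul, eval_add, eval_ofNat, eval_X, eval_one]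
    have h1 : ℓ ≤ c.eval (x.length + kη + kδ) := TM2Iter.eval_mono c (by omega)
    have h2 : m ≤ 4 * (x.length + kη + kδ) + 1 := by rw [hm, mOf]; omega
    exact Nat.mul_le_mul h2 h1
  -- one trial: the good outcomes are a `≥ 3/4` fraction
  set good : List.Vector Bool ℓ → Prop := fun v =>
    IsApproxCount kη (N x) (decodeNat (F (countQuery x 0 kη 4 v.toList))) with hgooddef
  have hgood : (1 / 2 + 1 / 4 : ℝ) * Fintype.card (List.Vector Bool ℓ) ≤
      (Finset.univ.filter good).card := by
    have hbad := hc x kη hkη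
    rw [show c.eval (x.length + kη) = ℓ from rfl] at hbad
    unfold uniformProb at hbad
    rw [div_le_iff₀ (by positivity)] at hbad
    have hbad' : ((Finset.univ.filter fun v : List.Vector Bool ℓ => ¬ good v).card : ℝ) ≤ 1 / 4 * 2 ^ ℓ := by
      refine le_of_eq_of_le ?_ hbad
      congr 2
      ext v
      simp [hgooddef, countEstimate_def]
    have hcomp : ((Finset.univ.filter fun v : List.Vector Bool ℓ => ¬ good v).card : ℝ) =
        Fintype.card (List.Vector Bool ℓ) - (Finset.univ.filter good).card := by
      rw [Finset.filter_not, Finset.card_sdiff_of_subset (Finset.filter_subset _ _), Finset.card_univ,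
        Nat.cast_sub (Finset.card_le_univ _)]
    rw [card_vector, Fintype.card_bool] at hcomp ⊢
    push_cast at hcomp ⊢
    linarith
  -- `m` trials: a strict majority fails with probability `≤ 1/kδ`
  set Q : (Fin m → List.Vector Bool ℓ) → Prop := fun ω =>
    2 * (Finset.univ.filter fun i => good (ω i)).card ≤ m with hQdef
  have hmaj : ((Finset.univ.filter Q).card : ℝ) ≤ 1 / (kδ : ℝ) * Fintype.card (Fin m → List.Vector Bool ℓ) := by
    refine card_majority_fail_le good (η := 1 / 4) (δ := 1 / (kδ : ℝ)) (by norm_num) (by positivity) ?_ hgood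
    have hk : (kδ : ℝ) ≠ 0 := by exact_mod_cast hkδ.ne'
    have h4 : (1 : ℝ) / (4 * (1 / (kδ : ℝ)) * (1 / 4) ^ 2) = 4 * kδ := by
      field_simp
    rw [h4, hm, mOf]
    push_cast
    linarith
  have hblocks : uniformProb (m * ℓ) {w | ∃ hw : w.length = m * ℓ, Q (chunkVec ⟨w, hw⟩)} ≤ 1 / (kδ : ℝ) := by
    rw [uniformProb_eq_card_of_bijective _ (chunkVec_bijective m ℓ) Q,
      div_le_iff₀ (by exact_mod_cast Fintype.card_pos)]
    exact hmaj
  -- failure of the median machine implies failure of a majority of the trials on the prefix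
  refine le_trans (APTransfer.uniformProb_mono_len fun U hU hfail => ?_)
    (APTransfer.uniformProb_take_le_of_le hcover _ hblocks)
  simp only [Set.mem_setOf_eq] at hfail ⊢
  have hlen : (U.take (m * ℓ)).length = m * ℓ := by rw [List.length_take]; omega
  refine ⟨hlen, ?_⟩
  by_contra hgoodmaj
  simp only [hQdef, not_le] at hgoodmaj
  apply hfail
  -- the machine outputs the median of the canonical estimates
  rw [countEstimate_def, medF_W c s F x kη kδ U hs]
  set L := List.ofFn fun j : Fin m => item c F x kη U j with hL
  set S := Com.isortModel [] L with hSdef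
  have hperm : S.Perm L := by simpa using Com.perm_isortModel L []
  have hSlen : S.length = m := by rw [hperm.length_eq, hL, List.length_ofFn]
  have hsorted : S.Pairwise ValLE := pairwise_isortModel L [] List.Pairwise.nil
  -- the strict majority of good trials is a strict majority of in-range items of `S`
  set P : List Bool → Bool := fun a =>
    decide ((N x : ℝ) / (1 + 1 / (kη : ℝ)) ≤ bitsToNat a ∧ (bitsToNat a : ℝ) ≤ (1 + 1 / (kη : ℝ)) * (N x)) with hP
  have hcount : (Finset.univ.filter fun i : Fin m => good (chunkVec ⟨U.take (m * ℓ), hlen⟩ i)).card ≤ S.countP P := by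
    have h1 : S.countP P = (Finset.univ.filter fun i : Fin m => P (item c F x kη U i) = true).card := by
      rw [hperm.countP_eq, hL, countP_ofFn_eq_card]
    rw [h1]
    refine Finset.card_le_card fun i hi => ?_
    simp only [Finset.mem_filter, Finset.mem_univ, true_and] at hi ⊢
    have hblk : (chunkVec ⟨U.take (m * ℓ), hlen⟩ i).toList = APTransfer.blk ℓ i U :=
      (blk_eq_chunkVec _ hlen i).symm.trans (blk_take ℓ m i.isLt U)
    have hi' : IsApproxCount kη (N x) (decodeNat (F (countQuery x 0 kη 4 (APTransfer.blk ℓ i U)))) := by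
      rw [hgooddef] at hi
      simpa only [hblk] using hi
    simp only [hP, item, bitsToNat_canonF, decide_eq_true_eq]
    exact hi' 
  have hmajS : S.length < 2 * S.countP P := by rw [hSlen]; omega
  have hmid := interval_of_majority hsorted hmajS
  rw [hSlen] at hmid
  have hdec : decodeNat (S.getD (m / 2) []) = bitsToNat (S.getD (m / 2) []) := by
    refine decodeNat_eq_bitsToNat_of_mem hperm ?_
    rw [List.getD_eq_getElem?_getD]
    cases h : S[m / 2]? with
    | none => exact Or.inr rfl
    | some a => exact Or.inl (List.mem_of_getElem? h)
  rw [hdec]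
  exact hmid

/-- **The two FPRAS notions coincide**: confidence parameter in unary iff the textbook constant `3/4`
(`HasFPRAS.threeQuartersFPRAS` and `hasFPRAS_of_threeQuarters`). [cite: JerrumValiantVazirani1986, Lemma 6.1] -/
theorem hasFPRAS_iff_threeQuarters' : HasFPRAS N ↔ ThreeQuartersFPRAS N :=
  ⟨HasFPRAS.threeQuartersFPRAS, hasFPRAS_of_threeQuarters⟩

end Amplify

end FPRASAmp

/-- **Jerrum–Valiant–Vazirani amplification for the tree's FPRAS notions**:
`ThreeQuartersFPRAS N → HasFPRAS N` (median of `4kδ + 1` independent runs). See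
`FPRASAmp.hasFPRAS_of_threeQuarters`. [cite: JerrumValiantVazirani1986, Lemma 6.1] -/
theorem ThreeQuartersFPRAS.hasFPRAS {N : List Bool → ℕ} (h : ThreeQuartersFPRAS N) : HasFPRAS N :=
  FPRASAmp.hasFPRAS_of_threeQuarters h

/-- **`HasFPRAS N ↔ ThreeQuartersFPRAS N`** (announced in `FPRAS.lean`). [cite: JerrumValiantVazirani1986, Lemma 6.1] -/
theorem hasFPRAS_iff_threeQuarters {N : List Bool → ℕ} : HasFPRAS N ↔ ThreeQuartersFPRAS N :=
  FPRASAmp.hasFPRAS_iff_threeQuarters'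

end Literature.Computability.Complexity

end
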